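import Literature.MathematicalPhysics.QuantumLattice.FreeFermiGasNoPairFieldLRO
import Literature.MathematicalPhysics.QuantumLattice.LTQOProofs
import Literature.Computability.AlgebraicComplexity.SubspaceProjection
import Literature.Barriers.HubbardSuperconductivity.PureModelStripeCompetitionProofs

/-!
# `LowEnergyRigidity` (crux stmt-HubbardSuperconductivity-1892, route `DeformationLadder`):
# the repulsion `0 < U` is load-bearing — at `U = 0` the rigidity matrix is FALSE for every
# doping, every window and every order (negative-side support, refuter crux-disprover seat)

`LowEnergyRigidity` claims: `∃ U>0, δ∈(0,½), κ>0, a>0, L₀, ∀ even L ≥ L₀`, every unit vector `φ` of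
`szSector N_L 0` (`N_L = 2⌊(1-δ)L²/2⌋`) with `Re⟨φ, H_L φ⟩ ≤ minEnergyOn H_L (szSector N_L 0) + κ`
(`H_L = hubbardTorus 2 L 1 U`) has `a ≤ L⁻⁴ Re⟨φ, Δ_dᴴΔ_d φ⟩` (`Δ_d = pairField dWaveFormFactor L`).

Here we record, sorry-free, that the hypothesis `0 < U` cannot be weakened to `0 ≤ U`
(all statements inline; no proposition is defined under `Summits/`):

* `exists_unit_mem_re_rayleigh_le_of_trace_le` — pigeonhole over an orthonormal frame: if the
  orthogonal projection `P_E` onto a subspace `E ≠ ⊥` has `Re tr (P_E Y) ≤ c · Re tr P_E`, some unit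
  vector `φ ∈ E` has `Re⟨φ, Y φ⟩ ≤ c` (the `≤` twin of the BalabanIR closer
  `forall_ground_le_re_rayleigh_of_penalised_trace_le`).
* `exists_unit_groundState_pairField_le_free` — on the FREE torus (`U = 0`, `L ≥ 3`), every joint
  sector `(2n, S^z = 0)`, `n ≤ L²`, contains a unit GROUND state `φ` (`H φ = E₀ φ`) with
  `Re⟨φ, Δ_dᴴΔ_d φ⟩ ≤ 32 L²` — an `L²`, not `L⁴`, law: the tree's selection rule
  `re_trace_sectorEigenProj_mul_pairField_dWave_le_free` (occupation-diagonal weights carry no pair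
  LRO, degenerate open shells included) plus the pigeonhole.
* `lowEnergyRigidity_false_without_repulsion` — hence the matrix of `LowEnergyRigidity` at
  `U = 0` fails for every `δ > -1`, every window `κ ≥ 0`, every order `a > 0` and every `L₀`:
  that ground state sits in every window and has LRO density `≤ 32/L² < a` once `aL² > 32`.

Moral for provers: any proof of `LowEnergyRigidity` must use the repulsion `U > 0` in an
essential way (the free Fermi gas is in every O(1) window's reach and carries no `d`-wave pair
LRO); a witness `a(U)` must vanish as `U → 0⁺` along any continuous family (cf. the weak-coupling
order ceiling `a ≤ 64√2·√U` of prover OCC's evidence files on the item). This file does NOT refute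
the crux.

References: J. Bardeen, L. N. Cooper, J. R. Schrieffer, Phys. Rev. 108 (1957) 1175, §II;
C. N. Yang, Rev. Mod. Phys. 34 (1962) 694, §3 (ODLRO bounds for free fermions); the tree's
`FreeFermiGasNoPairFieldLRO`.
-/

noncomputable section

set_option linter.dupNamespace false

namespace Summit.HubbardSuperconductivity.HubbardSuperconductivity.Theorems.LowEnergyRigidity.Negative

open Literature.MathematicalPhysics.QuantumLattice Matrix Literature.Barriers.HubbardSuperconductivity
open Literature.Computability.AlgebraicComplexity

/-! ### Pigeonhole over an orthonormal frame -/

section Pigeonhole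

variable {n : Type*} [Fintype n] [DecidableEq n]

/-- **Some unit vector of `E` is at most as `Y`-rich as the `E`-average.** For a subspace
`E ≠ ⊥` of `ℂⁿ` with orthogonal projection `P_E` (the tree's `projMatrix` of the Euclidean
transport of `E`) and any matrix `Y`: if `Re tr (P_E Y) ≤ c · Re tr P_E` then some unit vector
`φ ∈ E` has `Re⟨φ, Y φ⟩ ≤ c`. Proof: write `P_E = B Bᴴ` for an orthonormal frame `B` of `E`
(`exists_orthonormalFrame`, `proj_unique`); then `Re tr (P_E Y) = Σ_j Re⟨b_j, Y b_j⟩` and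
`Re tr P_E = dim E ≥ 1`, so some column works. Tasaki (2020) App. A.2. [folklore] -/
theorem exists_unit_mem_re_rayleigh_le_of_trace_le (E : Submodule ℂ (n → ℂ)) (hE : E ≠ ⊥)
    (Y : Matrix n n ℂ) (c : ℝ)
    (h : (projMatrix (E.map ((WithLp.linearEquiv 2 ℂ (n → ℂ)).symm :
        (n → ℂ) →ₗ[ℂ] EuclideanSpace ℂ n)) * Y).trace.re ≤
      c * (projMatrix (E.map ((WithLp.linearEquiv 2 ℂ (n → ℂ)).symm :
        (n → ℂ) →ₗ[ℂ] EuclideanSpace ℂ n))).trace.re) :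
    ∃ φ ∈ E, star φ ⬝ᵥ φ = 1 ∧ (star φ ⬝ᵥ Y *ᵥ φ).re ≤ c := by
  obtain ⟨k, B, hk, hBB, hcol, hfix⟩ := exists_orthonormalFrame E
  have hP : projMatrix (E.map
      ((WithLp.linearEquiv 2 ℂ (n → ℂ)).symm : (n → ℂ) →ₗ[ℂ] EuclideanSpace ℂ n)) = B * Bᴴ :=
    proj_unique (projMatrix_isHermitian _) (Matrix.isHermitian_mul_conjTranspose_self B)
      (fun _ hw => projMatrix_map_mulVec_of_mem E hw) (projMatrix_map_mulVec_mem E) hfix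
      (frame_proj_mulVec_mem hcol)
  have hdiag : ∀ j : Fin k,
      (Bᴴ * (Y * B)) j j = star (fun x => B x j) ⬝ᵥ Y *ᵥ (fun x => B x j) := by
    intro j
    simp only [Matrix.mul_apply, Matrix.conjTranspose_apply, dotProduct, Matrix.mulVec,
      Pi.star_apply]
  have hunit : ∀ j : Fin k, star (fun x => B x j) ⬝ᵥ (fun x => B x j) = 1 := by
    intro j
    have := congrFun (congrFun hBB j) j
    simpa [Matrix.mul_apply, Matrix.conjTranspose_apply, dotProduct, Matrix.one_apply] using this
  have hkpos : 0 < k := by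
    rw [hk]
    exact Submodule.one_le_finrank_iff.mpr hE
  rw [hP, frame_proj_trace hBB, Matrix.mul_assoc, Matrix.trace_mul_comm, Matrix.mul_assoc,
    Matrix.trace] at h
  simp only [Matrix.diag_apply, Complex.re_sum, Complex.natCast_re] at h
  have hsum : ∑ j : Fin k, ((Bᴴ * (Y * B)) j j).re ≤ ∑ _j : Fin k, c := by
    simpa [mul_comm] using h
  haveI : Nonempty (Fin k) := ⟨⟨0, hkpos⟩⟩
  obtain ⟨j, -, hj⟩ := Finset.exists_le_of_sum_le Finset.univ_nonempty hsum
  rw [hdiag] at hj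
  exact ⟨fun x => B x j, hcol j, hunit j, hj⟩

end Pigeonhole

/-! ### The free torus: a pair-poor ground state in every sector -/

/-- **A pair-poor free ground state.** On the free fermionic torus (`U = 0`, `t = 1`, `L ≥ 3`),
for every `n ≤ L²` the joint sector `(2n, S^z = 0)` contains a unit ground state `φ` of
`hubbardTorus 2 L 1 0` — `φ ∈ szSector (2n) 0`, `H φ = minEnergyOn H (szSector (2n) 0) • φ` — with
`Re⟨φ, Δ_dᴴΔ_d φ⟩ ≤ 32 L²`: the sector ground eigenspace `E` is `≠ ⊥`
(`exists_unit_isGroundStateInSector_hubbardTorus`), its projection obeys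
`Re tr (P_E Δ_dᴴΔ_d) ≤ 32 L² Re tr P_E` (`re_trace_sectorEigenProj_mul_pairField_dWave_le_free`),
and the pigeonhole picks the vector. BCS (1957) §II; Yang (1962) §3. [folklore] -/
theorem exists_unit_groundState_pairField_le_free (L : ℕ) [NeZero L] (hL : 3 ≤ L) {n : ℕ}
    (hn : n ≤ L ^ 2) :
    ∃ φ : Fock (Orb (FermionTorus 2 L)), φ ∈ szSector (Λ := FermionTorus 2 L) (2 * n) 0 ∧
      star φ ⬝ᵥ φ = 1 ∧
      hubbardTorus 2 L 1 0 *ᵥ φ =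
        (((hubbardTorus 2 L 1 0).minEnergyOn (szSector (Λ := FermionTorus 2 L) (2 * n) 0) : ℝ) : ℂ)
          • φ ∧
      (star φ ⬝ᵥ ((pairField dWaveFormFactor L)ᴴ * pairField dWaveFormFactor L) *ᵥ φ).re ≤
        32 * (L : ℝ) ^ 2 := by
  set H := hubbardTorus 2 L 1 0 with hH
  set S := szSector (Λ := FermionTorus 2 L) (2 * n) 0 with hS
  set e : ℂ := ((H.minEnergyOn S : ℝ) : ℂ) with he
  set E : Submodule ℂ (Fock (Orb (FermionTorus 2 L))) :=
    S ⊓ Module.End.eigenspace (Matrix.toLin' H) e with hEdef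
  -- the sector ground eigenspace is nontrivial
  have hE : E ≠ ⊥ := by
    obtain ⟨ψ, -, hψS, hψ0, hψeig⟩ := exists_unit_isGroundStateInSector_hubbardTorus 0 L n hn
    rw [Submodule.ne_bot_iff]
    refine ⟨ψ, ?_, hψ0⟩
    rw [hEdef, Submodule.mem_inf, Module.End.mem_eigenspace_iff, Matrix.toLin'_apply]
    exact ⟨hψS, hψeig⟩
  -- the free selection rule on the ground eigenspace
  have hfree := re_trace_sectorEigenProj_mul_pairField_dWave_le_free (L := L) hL (2 * n) 0 e
  simp only at hfree
  obtain ⟨φ, hφE, hφ1, hφY⟩ := exists_unit_mem_re_rayleigh_le_of_trace_le E hE _ _ hfree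
  rw [hEdef, Submodule.mem_inf, Module.End.mem_eigenspace_iff, Matrix.toLin'_apply] at hφE
  exact ⟨φ, hφE.1, hφ1, hφE.2, hφY⟩

/-- **The repulsion is load-bearing: at `U = 0` the rigidity matrix of `LowEnergyRigidity` is false
for every doping `δ > -1`, every window `κ ≥ 0`, every order `a > 0` and every `L₀`.** At an even
side `L ≥ max(L₀, 3)` with `a L² > 32`, the pair-poor free ground state of
`exists_unit_groundState_pairField_le_free` is a unit vector of `szSector N_L 0` of energy exactly
`minEnergyOn` (inside every window) whose LRO density is `≤ 32/L² < a`. So `0 < U` cannot be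
weakened to `0 ≤ U` in the crux, and any witness order `a(U)` is not bounded below as `U → 0⁺`
through `U = 0`. BCS (1957) §II; Yang (1962) §3. [folklore] -/
theorem lowEnergyRigidity_false_without_repulsion :
    ¬ ∃ δ : ℝ, -1 < δ ∧ ∃ κ : ℝ, 0 ≤ κ ∧ ∃ a : ℝ, 0 < a ∧ ∃ L₀ : ℕ, ∀ (L : ℕ) [NeZero L], L₀ ≤ L →
      Even L → ∀ φ : Fock (Orb (FermionTorus 2 L)),
        φ ∈ szSector (2 * ⌊(1 - δ) * (L : ℝ) ^ 2 / 2⌋₊) 0 → star φ ⬝ᵥ φ = 1 →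
        (star φ ⬝ᵥ Matrix.mulVec (hubbardTorus 2 L 1 0) φ).re ≤
          (hubbardTorus 2 L 1 0).minEnergyOn (szSector (2 * ⌊(1 - δ) * (L : ℝ) ^ 2 / 2⌋₊) 0) + κ →
        a ≤ (expect ((pairField dWaveFormFactor L)ᴴ * pairField dWaveFormFactor L) φ).re /
          (L : ℝ) ^ 4 := by
  rintro ⟨δ, hδ, κ, hκ, a, ha, L₀, h⟩
  -- an even side `L ≥ max(L₀, 3)` with `a L² > 32`
  set M : ℕ := ⌈32 / a⌉₊ with hM
  set L : ℕ := 2 * (max L₀ M + 2) with hLdef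
  have hL0 : L₀ ≤ L := by have := le_max_left L₀ M; omega
  have hLM : M + 1 ≤ L := by have := le_max_right L₀ M; omega
  have hL3 : 3 ≤ L := by omega
  haveI : NeZero L := ⟨by omega⟩
  have hev : Even L := even_two_mul _
  have hLreal : 32 / a < (L : ℝ) := by
    have h1 : 32 / a ≤ (M : ℝ) := Nat.le_ceil _
    have h2 : (M : ℝ) + 1 ≤ L := by exact_mod_cast hLM
    linarith
  have haL : 32 < a * (L : ℝ) ^ 2 := by
    have h1 : 32 < a * L := by
      rw [div_lt_iff₀ ha] at hLreal; linarith
    have hL1 : (1 : ℝ) ≤ L := by exact_mod_cast (show 1 ≤ L by omega)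
    nlinarith
  -- the pair-poor free ground state sits in the window
  obtain ⟨φ, hφS, hφ1, hφeig, hφY⟩ :=
    exists_unit_groundState_pairField_le_free L hL3 (natFloor_filling_le_sq hδ.le L)
  have hwin : (star φ ⬝ᵥ Matrix.mulVec (hubbardTorus 2 L 1 0) φ).re ≤
      (hubbardTorus 2 L 1 0).minEnergyOn (szSector (2 * ⌊(1 - δ) * (L : ℝ) ^ 2 / 2⌋₊) 0) + κ := by
    rw [hφeig, dotProduct_smul, hφ1, smul_eq_mul, mul_one, Complex.ofReal_re]
    linarith
  have hLRO := h L hL0 hev φ hφS hφ1 hwin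
  -- but its LRO density is `≤ 32/L² < a`
  have hL2 : (0 : ℝ) < (L : ℝ) ^ 2 := by positivity
  have hL4 : (0 : ℝ) < (L : ℝ) ^ 4 := by positivity
  simp only [Literature.MathematicalPhysics.QuantumLattice.expect] at hLRO
  rw [le_div_iff₀ hL4] at hLRO
  have : a * (L : ℝ) ^ 4 ≤ 32 * (L : ℝ) ^ 2 := hLRO.trans hφY
  nlinarith

end Summit.HubbardSuperconductivity.HubbardSuperconductivity.Theorems.LowEnergyRigidity.Negative

end
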